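import Literature.AlgebraicGeometry.ProjectiveSpace.PointsVanishingIdeal
import HarnessLib

/-!
# Points on a hypersurface impose at most `dim S_d − dim S_{d−q}` conditions on forms of degree `d`;
# plane points on a conic impose at most `2d + 1` (Eisenbud–Green–Harris 1996, proof of Prop. 1)

Topic `Literature/AlgebraicGeometry/ProjectiveSpace`, namespace
`Literature.AlgebraicGeometry.ProjectiveSpace`. Lane `lit-hodgefound`, seat `lit-hodgefound-p32`,
row gen25-#11. Theorems only (no definition, no named fact).

## The source, as printed

D. Eisenbud, M. Green, J. Harris, *Cayley–Bacharach theorems and conjectures*, Bull. AMS 33 (1996),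
§1.1, Proposition 1 (p. 300): "Let `Ω = {p_1, …, p_n} ⊂ ℙ²` be any collection of `n ≤ 2d + 2` distinct
points. The points of `Ω` fail to impose independent conditions on curves of degree `d` if and only if
either `d + 2` of the points of `Ω` are collinear or `n = 2d + 2` and `Ω` is contained in a conic." Proof
of "if": "If `d + 2` of the points of `Ω` lie on a line `L`, then by Bézout's Theorem any curve of degree
`d` containing `Ω` must contain `L`. The subset of curves of degree `d` containing `L` has the same
dimension as the set of curves of degree `d − 1`, so the codimension of the set of curves containing `L`
is only `d + 1` … A similar argument, using the fact that it is only `2d + 1` conditions to contain an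
irreducible conic, works in the second case."

## Dictionary

As in `ProjectiveSpace/PointsVanishingIdeal`: `Z ⊆ ℙ(k^σ)` a set of representing vectors,
`I(Z) = projVanishingIdeal Z`, `H_Z(d) = dim_k S_d − dim_k I(Z)_d`. "`Z` lies on the hypersurface
`Q = 0`" is `∀ p ∈ Z, Q(p) = 0` for a non-zero form `Q` of degree `q`; then `Q · S_{d−q} ⊆ I(Z)_d`
(the forms of degree `d` "containing the hypersurface"), a subspace of dimension `dim S_{d−q}`.

## What is here (all `theorem`s)

* § 1 `finrank_homogeneousSubmodule_le_finrank_idealDegree_of_hypersurface` (`dim S_t ≤ dim I(Z)_{t+q}`),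
  **`hilbert_projVanishingIdeal_le_of_hypersurface`** (`H_Z(t + q) ≤ dim S_{t+q} − dim S_t`).
* § 2 plane curves (`σ = Fin 3`, `dim S_n = binom(n+2, 2)`): `hilbert_projVanishingIdeal_le_of_planeCurve`
  (`H_Z(t + q) ≤ binom(t+q+2, 2) − binom(t+2, 2)`), **`hilbert_projVanishingIdeal_le_of_conic`** — points
  on a conic impose at most `2d + 1` conditions on curves of degree `d` ("it is only `2d + 1` conditions
  to contain a conic") — and **`hilbert_projVanishingIdeal_lt_card_of_conic`**: `n ≥ 2d + 2` points on a
  conic fail to impose independent conditions on curves of degree `d` (the "if" of Prop. 1, second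
  case). The line case (`H ≤ d + 1`) is `PointsLinearSpanHilbertFunction.hilbert_projVanishingIdeal_le_succ_of_mem_span_pair`.
  NOT here: the "only if" of the conic case.

## References

* [EisenbudGreenHarris1996] D. Eisenbud, M. Green, J. Harris, *Cayley–Bacharach theorems and
  conjectures*, Bull. Amer. Math. Soc. 33 (1996), §1.1, Prop. 1 and its proof (p. 300).
-/

noncomputable section

open MvPolynomial Module
open Literature.RingTheory.MvPolynomial

universe u

namespace Literature.AlgebraicGeometry.ProjectiveSpace

variable {k : Type u} [Field k] {σ : Type*}

/-! ### § 1 Points on a hypersurface of degree `q` -/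

/-- **`Q · S_t ⊆ I(Z)_{t+q}`, so `dim S_t ≤ dim I(Z)_{t+q}`**, for `Z` on the hypersurface `Q = 0`
(`Q ≠ 0` a form of degree `q`): multiplication by `Q` is injective ("the subset of curves of degree `d`
containing `L` has the same dimension as the set of curves of degree `d − 1`").
[cite: EisenbudGreenHarris1996, §1.1, proof of Prop. 1 (p. 300)] -/
theorem finrank_homogeneousSubmodule_le_finrank_idealDegree_of_hypersurface [Finite σ]
    {Z : Set (σ → k)} {Q : MvPolynomial σ k} {q : ℕ} (hQ : Q.IsHomogeneous q) (hQ0 : Q ≠ 0)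
    (hZ : ∀ p ∈ Z, MvPolynomial.eval p Q = 0) (t : ℕ) :
    finrank k (homogeneousSubmodule σ k t) ≤ finrank k (idealDegree (projVanishingIdeal Z) (t + q)) := by
  haveI := finite_homogeneousSubmodule (K := k) (σ := σ) t
  have hQI : Q ∈ projVanishingIdeal Z := mem_projVanishingIdeal_of_isHomogeneous hQ hZ
  have hle : (homogeneousSubmodule σ k t).map (LinearMap.mulLeft k Q) ≤
      idealDegree (projVanishingIdeal Z) (t + q) := by
    rintro _ ⟨r, hr, rfl⟩
    refine mem_idealDegree.mpr ⟨Ideal.mul_mem_right r _ hQI, ?_⟩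
    rw [LinearMap.mulLeft_apply, add_comm]
    exact hQ.mul ((mem_homogeneousSubmodule t r).mp hr)
  rw [← finrank_map_mulLeft hQ0 (homogeneousSubmodule σ k t)]
  exact Submodule.finrank_mono hle

/-- **Points on a hypersurface of degree `q` impose at most `dim_k S_{t+q} − dim_k S_t` conditions on
forms of degree `t + q`**: `H_Z(t + q) ≤ dim S_{t+q} − dim S_t`.
[cite: EisenbudGreenHarris1996, §1.1, proof of Prop. 1 (p. 300)] -/
theorem hilbert_projVanishingIdeal_le_of_hypersurface [Finite σ] {Z : Set (σ → k)}
    {Q : MvPolynomial σ k} {q : ℕ} (hQ : Q.IsHomogeneous q) (hQ0 : Q ≠ 0)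
    (hZ : ∀ p ∈ Z, MvPolynomial.eval p Q = 0) (t : ℕ) :
    finrank k (homogeneousSubmodule σ k (t + q)) - finrank k (idealDegree (projVanishingIdeal Z) (t + q)) ≤
      finrank k (homogeneousSubmodule σ k (t + q)) - finrank k (homogeneousSubmodule σ k t) := by
  have h := finrank_homogeneousSubmodule_le_finrank_idealDegree_of_hypersurface hQ hQ0 hZ t
  omega

/-! ### § 2 Plane curves: points on a curve of degree `q`, on a conic -/

/-- `dim_k k[x_0, x_1, x_2]_n = binom(n + 2, 2)`. [cite: EisenbudGreenHarris1996, §1.1 (p. 299)] -/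
theorem finrank_homogeneousSubmodule_fin_three (n : ℕ) :
    finrank k (homogeneousSubmodule (Fin 3) k n) = (n + 2).choose 2 := by
  rw [Literature.RingTheory.HilbertSamuel.finrank_homogeneousSubmodule_fin k 3 n,
    show n + 3 - 1 = n + 2 by omega]
  exact Nat.choose_symm_add

/-- **Plane points on a curve of degree `q` impose at most `binom(t+q+2, 2) − binom(t+2, 2)` conditions
on curves of degree `t + q`** (`= dq − q(q−3)/2` with `d = t + q`).
[cite: EisenbudGreenHarris1996, §1.1, proof of Prop. 1 (p. 300)] -/
theorem hilbert_projVanishingIdeal_le_of_planeCurve {Z : Set (Fin 3 → k)} {Q : MvPolynomial (Fin 3) k}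
    {q : ℕ} (hQ : Q.IsHomogeneous q) (hQ0 : Q ≠ 0) (hZ : ∀ p ∈ Z, MvPolynomial.eval p Q = 0) (t : ℕ) :
    finrank k (homogeneousSubmodule (Fin 3) k (t + q)) -
        finrank k (idealDegree (projVanishingIdeal Z) (t + q)) ≤
      (t + q + 2).choose 2 - (t + 2).choose 2 := by
  have h := hilbert_projVanishingIdeal_le_of_hypersurface hQ hQ0 hZ t
  rw [finrank_homogeneousSubmodule_fin_three, finrank_homogeneousSubmodule_fin_three] at h
  rw [finrank_homogeneousSubmodule_fin_three]
  exact h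

/-- **Points on a conic impose at most `2d + 1` conditions on curves of degree `d`** ("it is only
`2d + 1` conditions to contain an irreducible conic"; irreducibility is not needed for the bound).
[cite: EisenbudGreenHarris1996, §1.1, proof of Prop. 1 (p. 300)] -/
theorem hilbert_projVanishingIdeal_le_of_conic {Z : Set (Fin 3 → k)} {Q : MvPolynomial (Fin 3) k}
    (hQ : Q.IsHomogeneous 2) (hQ0 : Q ≠ 0) (hZ : ∀ p ∈ Z, MvPolynomial.eval p Q = 0) (d : ℕ) :
    finrank k (homogeneousSubmodule (Fin 3) k d) - finrank k (idealDegree (projVanishingIdeal Z) d) ≤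
      2 * d + 1 := by
  rcases Nat.lt_or_ge d 2 with hd | hd
  · -- `H_Z(d) ≤ dim S_d = 1, 3`
    refine (Nat.sub_le _ _).trans ?_
    rw [finrank_homogeneousSubmodule_fin_three]
    interval_cases d <;> decide
  · obtain ⟨t, rfl⟩ := Nat.exists_eq_add_of_le' hd
    refine (hilbert_projVanishingIdeal_le_of_planeCurve hQ hQ0 hZ t).trans ?_
    have h1 : (t + 2 + 2).choose 2 = (t + 3) + ((t + 2) + (t + 2).choose 2) := by
      rw [show t + 2 + 2 = (t + 3) + 1 by omega, Nat.choose_succ_succ' (t + 3) 1, Nat.choose_one_right,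
        show t + 3 = (t + 2) + 1 by omega, Nat.choose_succ_succ' (t + 2) 1, Nat.choose_one_right]
    omega

/-- **EGH Prop. 1, "if", second case: `n ≥ 2d + 2` points on a conic fail to impose independent
conditions on curves of degree `d`** (`H_Z(d) ≤ 2d + 1 < n`).
[cite: EisenbudGreenHarris1996, §1.1, Prop. 1 (p. 300)] -/
theorem hilbert_projVanishingIdeal_lt_card_of_conic {ι : Type*} [Fintype ι] (P : ι → Fin 3 → k)
    {Q : MvPolynomial (Fin 3) k} (hQ : Q.IsHomogeneous 2) (hQ0 : Q ≠ 0)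
    (hZ : ∀ i, MvPolynomial.eval (P i) Q = 0) {d : ℕ} (hcard : 2 * d + 2 ≤ Fintype.card ι) :
    finrank k (homogeneousSubmodule (Fin 3) k d) - finrank k (idealDegree (projVanishingIdeal (Set.range P)) d) <
      Fintype.card ι := by
  have h := hilbert_projVanishingIdeal_le_of_conic hQ hQ0 (Z := Set.range P)
    (by rintro _ ⟨i, rfl⟩; exact hZ i) d
  omega

end Literature.AlgebraicGeometry.ProjectiveSpace

end
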